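import Mathlib
import Summits.PneNP.PneNP.Theorems.RamseyUncertifiableRegularResolutionRungTrapSparseFalseBiDense

/-!
# The trap family of the points/hyperplanes graph (helper 5a for `stub_not_biDenseTrapSparse`)

For an `r`-tuple `t` of hyperplanes with linearly independent normals, the `(r+1)`-set
`Bset t = {t 0, …, t (r-1), p⋆}`, `p⋆ := (Σ aᵢ, 1 + Σ bᵢ)`, has: no common point (the `r+1` incidence
equations sum to `0 = 1`), while every PROPER subset has linearly independent normals (so its common points
form an affine subspace with exactly `2^(d - |U|)` points). Over `F₂` linear independence is the absence of a
non-empty zero subset-sum (`linIndep_iff_subsetSum`), which makes the bookkeeping finitary. We also count the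
tuples: at least `(2^d − 2^r)^r · 2^r`. [folklore]
-/

noncomputable section

open Finset Matrix

namespace Summit.PneNP.PneNP.Cruxes.RegularResolutionRung.SoundPathBottleneck.HadamardWitness

set_option linter.dupNamespace false -- `Summit.PneNP.PneNP.…`: single-conjunct summit (D-0017)

variable {d r : ℕ}

/-- **Independence over `F₂` = no non-empty zero subset-sum.** -/
theorem linIndep_iff_subsetSum {ι : Type*} [DecidableEq ι] (f : ι → Vec d) :
    LinearIndependent (ZMod 2) f ↔ ∀ S : Finset ι, ∑ i ∈ S, f i = 0 → S = ∅ := by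
  rw [linearIndependent_iff']
  constructor
  · intro h S hS
    have h' := h S (fun i => if i ∈ S then 1 else 0) (by
      rw [← hS]
      refine Finset.sum_congr rfl fun i hi => ?_
      simp [hi])
    by_contra hne
    obtain ⟨i, hi⟩ := Finset.nonempty_iff_ne_empty.2 hne
    have := h' i hi
    simp [hi] at this
  · intro h S g hg i hi
    -- the support of `g` inside `S` sums to zero
    set T := S.filter fun j => g j = 1 with hT
    have hsum : ∑ j ∈ T, f j = 0 := by
      have e : ∑ j ∈ T, f j = ∑ j ∈ S, g j • f j := by
        rw [hT, Finset.sum_filter]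
        refine Finset.sum_congr rfl fun j _ => ?_
        rcases zmod2_cases (g j) with h0 | h1
        · simp [h0]
        · simp [h1]
      rw [e, hg]
    have hTe := h T hsum
    rcases zmod2_cases (g i) with h0 | h1
    · exact h0
    · exfalso
      have : i ∈ T := by rw [hT, Finset.mem_filter]; exact ⟨hi, h1⟩
      rw [hTe] at this
      simp at this

/-- Independence of the normals of a finset of hyperplanes, subset-sum form. -/
theorem indepNormals_of_subsetSum (U : Finset (Hyp d))
    (h : ∀ S ⊆ U, ∑ p ∈ S, p.a = 0 → S = ∅) : IndepNormals U := by
  classical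
  unfold IndepNormals
  rw [linIndep_iff_subsetSum]
  intro S hS
  have hS' : ∑ p ∈ S.map (Function.Embedding.subtype _), (p : Hyp d).a = 0 := by
    rw [Finset.sum_map]; exact hS
  have := h (S.map (Function.Embedding.subtype _)) (fun p hp => by
    rw [Finset.mem_map] at hp
    obtain ⟨q, -, rfl⟩ := hp
    exact q.2) hS'
  rwa [Finset.map_eq_empty] at this

/-! ## The trap attached to an independent tuple of hyperplanes -/

/-- Tuples of hyperplanes with linearly independent normals. -/
def HypTuples (d r : ℕ) : Finset (Fin r → Hyp d) := by
  classical exact univ.filter fun t => LinearIndependent (ZMod 2) fun i => (t i).a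

/-- Membership in `HypTuples`. -/
theorem mem_HypTuples {t : Fin r → Hyp d} :
    t ∈ HypTuples d r ↔ LinearIndependent (ZMod 2) fun i => (t i).a := by
  classical
  unfold HypTuples; simp

/-- The sum of the normals of an independent tuple is non-zero (for `r ≥ 1`). -/
theorem sum_normals_ne_zero (hr : 1 ≤ r) {t : Fin r → Hyp d} (ht : LinearIndependent (ZMod 2) fun i => (t i).a) :
    ∑ i, (t i).a ≠ 0 := by
  classical
  intro h0
  have := (linIndep_iff_subsetSum _).1 ht univ h0
  have hne : (univ : Finset (Fin r)).Nonempty := ⟨⟨0, hr⟩, Finset.mem_univ _⟩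
  rw [this] at hne
  simp at hne

/-- The completing hyperplane `p⋆ = (Σ aᵢ, 1 + Σ bᵢ)`. -/
def pstar (hr : 1 ≤ r) (t : Fin r → Hyp d) (ht : LinearIndependent (ZMod 2) fun i => (t i).a) : Hyp d :=
  ⟨(∑ i, (t i).a, 1 + ∑ i, (t i).b), sum_normals_ne_zero hr ht⟩

/-- The `(r+1)`-set of hyperplanes of the trap. -/
def Bset (hr : 1 ≤ r) (t : Fin r → Hyp d) (ht : LinearIndependent (ZMod 2) fun i => (t i).a) : Finset (Hyp d) :=
  insert (pstar hr t ht) (univ.image t)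

variable {t : Fin r → Hyp d}

/-- An independent tuple is injective. -/
theorem tuple_injective (ht : LinearIndependent (ZMod 2) fun i => (t i).a) : Function.Injective t := by
  intro i j hij
  exact ht.injective (by simp [hij])

/-- `x + x = 0` in `F₂^d`. -/
theorem vec_add_self (x : Vec d) : x + x = 0 := by
  funext l
  exact CharTwo.add_self_eq_zero (x l)

/-- `p⋆` is not one of the `t i` (for `r ≥ 2` its normal differs). -/
theorem pstar_not_mem_image (hr : 2 ≤ r) (ht : LinearIndependent (ZMod 2) fun i => (t i).a) :
    pstar (by omega) t ht ∉ univ.image t := by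
  classical
  intro hmem
  rw [Finset.mem_image] at hmem
  obtain ⟨j, -, hj⟩ := hmem
  have ha : (t j).a = ∑ i, (t i).a := by
    have := congrArg (fun p : Hyp d => p.a) hj
    simpa [pstar] using this
  -- then the normals of the indices ≠ j sum to zero, a non-empty zero subset-sum
  have hsum : ∑ i ∈ univ.erase j, (t i).a = 0 := by
    have h1 := Finset.sum_erase_add univ (fun i => (t i).a) (Finset.mem_univ j)
    rw [← ha] at h1
    -- Σ_{i≠j} aᵢ + aⱼ = aⱼ  ⇒  Σ_{i≠j} aᵢ = 0
    calc ∑ i ∈ univ.erase j, (t i).a = ∑ i ∈ univ.erase j, (t i).a + ((t j).a + (t j).a) := by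
          rw [vec_add_self, add_zero]
      _ = (∑ i ∈ univ.erase j, (t i).a + (t j).a) + (t j).a := by rw [add_assoc]
      _ = (t j).a + (t j).a := by rw [h1]
      _ = 0 := vec_add_self _
  have := (linIndep_iff_subsetSum _).1 ht (univ.erase j) hsum
  have hne : (univ.erase j : Finset (Fin r)).Nonempty := by
    rw [← Finset.card_pos, Finset.card_erase_of_mem (Finset.mem_univ _), Finset.card_univ, Fintype.card_fin]
    omega
  rw [this] at hne
  simp at hne

/-- The trap has `r + 1` hyperplanes (`r ≥ 2`). -/
theorem card_Bset (hr : 2 ≤ r) (ht : LinearIndependent (ZMod 2) fun i => (t i).a) :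
    (Bset (by omega) t ht).card = r + 1 := by
  classical
  unfold Bset
  rw [Finset.card_insert_of_notMem (pstar_not_mem_image hr ht), Finset.card_image_of_injective _ (tuple_injective ht),
    Finset.card_univ, Fintype.card_fin]

/-- Members of the trap. -/
theorem mem_Bset {hr : 1 ≤ r} {ht : LinearIndependent (ZMod 2) fun i => (t i).a} {p : Hyp d} :
    p ∈ Bset hr t ht ↔ p = pstar hr t ht ∨ ∃ i, t i = p := by
  classical
  unfold Bset
  simp

/-- **Proper subsets of the trap have linearly independent normals.** -/
theorem indepNormals_of_ssubset (hr : 1 ≤ r) (ht : LinearIndependent (ZMod 2) fun i => (t i).a)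
    {U : Finset (Hyp d)} (hU : U ⊆ Bset hr t ht) (hne : U ≠ Bset hr t ht) : IndepNormals U := by
  classical
  apply indepNormals_of_subsetSum
  intro S hS hsum
  -- indices of the tuple occurring in S
  set I : Finset (Fin r) := univ.filter fun i => t i ∈ S with hI
  have hSsub : S ⊆ Bset hr t ht := hS.trans hU
  by_cases hp : pstar hr t ht ∈ S
  · -- then some `t j` is missing from `U`, and the missing normals sum to zero
    exfalso
    have hj : ∃ j, t j ∉ U := by
      by_contra hall
      push Not at hall
      apply hne
      apply Finset.Subset.antisymm hU
      intro p hpB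
      rcases (mem_Bset).1 hpB with rfl | ⟨i, rfl⟩
      · exact hS hp
      · exact hall i
    obtain ⟨j, hjU⟩ := hj
    have hjI : j ∉ I := by
      rw [hI, Finset.mem_filter]; exact fun h => hjU (hS h.2)
    -- S = insert p⋆ (I.image t)
    have hSeq : S = insert (pstar hr t ht) (I.image t) := by
      ext p
      constructor
      · intro hpS
        rcases (mem_Bset).1 (hSsub hpS) with rfl | ⟨i, rfl⟩
        · exact Finset.mem_insert_self _ _
        · refine Finset.mem_insert_of_mem (Finset.mem_image.2 ⟨i, ?_, rfl⟩)
          rw [hI, Finset.mem_filter]; exact ⟨Finset.mem_univ _, hpS⟩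
      · intro hp'
        rcases Finset.mem_insert.1 hp' with rfl | him
        · exact hp
        · obtain ⟨i, hi, rfl⟩ := Finset.mem_image.1 him
          rw [hI, Finset.mem_filter] at hi; exact hi.2
    have hnot : pstar hr t ht ∉ I.image t := by
      intro h
      obtain ⟨i, -, hi⟩ := Finset.mem_image.1 h
      -- t i = p⋆ forces t i ∈ S and … we only need that the image of t misses p⋆ when r ≥ 2;
      -- here we argue directly: the normal of p⋆ is the full sum, a non-trivial combination
      have ha : (t i).a = ∑ k, (t k).a := by
        have := congrArg (fun p : Hyp d => p.a) hi; simpa [pstar] using this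
      have hsum0 : ∑ k ∈ univ.erase i, (t k).a = 0 := by
        have h1 := Finset.sum_erase_add univ (fun k => (t k).a) (Finset.mem_univ i)
        rw [← ha] at h1
        calc ∑ k ∈ univ.erase i, (t k).a = ∑ k ∈ univ.erase i, (t k).a + ((t i).a + (t i).a) := by
              rw [vec_add_self, add_zero]
          _ = (∑ k ∈ univ.erase i, (t k).a + (t i).a) + (t i).a := by rw [add_assoc]
          _ = 0 := by rw [h1]; exact vec_add_self _
      have hemp := (linIndep_iff_subsetSum _).1 ht _ hsum0
      -- univ.erase i = ∅ forces r = 1, and then t i ∉ U would mean … but t i = p⋆ ∈ S ⊆ U while j ≠ i impossible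
      have hr1 : r = 1 := by
        have := congrArg Finset.card hemp
        rw [Finset.card_erase_of_mem (Finset.mem_univ _), Finset.card_univ, Fintype.card_fin,
          Finset.card_empty] at this
        omega
      subst hr1
      have hij : j = i := Subsingleton.elim (α := Fin 1) j i
      rw [hij] at hjU
      exact hjU (hS (hi ▸ hp))
    have hsum' : ∑ p ∈ S, p.a = (∑ k, (t k).a) + ∑ k ∈ I, (t k).a := by
      rw [hSeq, Finset.sum_insert hnot, Finset.sum_image (fun x _ y _ h => tuple_injective ht h)]
      rfl
    rw [hsum'] at hsum
    -- hence the normals outside I sum to zero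
    have hsplit := Finset.sum_filter_add_sum_filter_not univ (fun i => t i ∈ S) (fun k => (t k).a)
    rw [← hI] at hsplit
    have hzero : ∑ k ∈ univ.filter (fun i => ¬ t i ∈ S), (t k).a = 0 := by
      calc ∑ k ∈ univ.filter (fun i => ¬ t i ∈ S), (t k).a
          = (∑ k ∈ I, (t k).a + ∑ k ∈ univ.filter (fun i => ¬ t i ∈ S), (t k).a) + ∑ k ∈ I, (t k).a := by
            rw [add_comm (∑ k ∈ I, (t k).a), add_assoc, vec_add_self, add_zero]
        _ = (∑ k, (t k).a) + ∑ k ∈ I, (t k).a := by rw [hsplit]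
        _ = 0 := hsum
    have hemp := (linIndep_iff_subsetSum _).1 ht _ hzero
    have : j ∈ univ.filter (fun i => ¬ t i ∈ S) := by
      rw [Finset.mem_filter]; exact ⟨Finset.mem_univ _, fun h => hjU (hS h)⟩
    rw [hemp] at this
    simp at this
  · -- S ⊆ image t: then S = I.image t and I = ∅
    have hSeq : S = I.image t := by
      ext p
      constructor
      · intro hpS
        rcases (mem_Bset).1 (hSsub hpS) with rfl | ⟨i, rfl⟩
        · exact absurd hpS hp
        · refine Finset.mem_image.2 ⟨i, ?_, rfl⟩
          rw [hI, Finset.mem_filter]; exact ⟨Finset.mem_univ _, hpS⟩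
      · intro him
        obtain ⟨i, hi, rfl⟩ := Finset.mem_image.1 him
        rw [hI, Finset.mem_filter] at hi; exact hi.2
    have hsum' : ∑ k ∈ I, (t k).a = 0 := by
      rw [hSeq, Finset.sum_image (fun x _ y _ h => tuple_injective ht h)] at hsum
      exact hsum
    have hemp := (linIndep_iff_subsetSum _).1 ht _ hsum'
    rw [hSeq, hemp, Finset.image_empty]

/-- **The trap closes:** no point lies on all `r + 1` hyperplanes. -/
theorem ptsOn_Bset (hr : 1 ≤ r) (ht : LinearIndependent (ZMod 2) fun i => (t i).a) :
    ptsOn (Bset hr t ht) = ∅ := by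
  classical
  rw [Finset.eq_empty_iff_forall_notMem]
  intro x hx
  rw [ptsOn, Finset.mem_filter] at hx
  have hall := hx.2
  have hti : ∀ i, (t i).a ⬝ᵥ x = (t i).b := fun i => hall (t i) ((mem_Bset).2 (Or.inr ⟨i, rfl⟩))
  have hstar := hall (pstar hr t ht) ((mem_Bset).2 (Or.inl rfl))
  simp only [pstar] at hstar
  rw [sum_dotProduct] at hstar
  simp_rw [hti] at hstar
  have hstar' : ∑ i, (t i).b = 1 + ∑ i, (t i).b := by simpa only [Hyp.b] using hstar
  -- Σ bᵢ = 1 + Σ bᵢ gives 0 = 1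
  have h2 : (∑ i, (t i).b) + ∑ i, (t i).b = (1 + ∑ i, (t i).b) + ∑ i, (t i).b := by rw [← hstar']
  have : (0 : ZMod 2) = 1 := by
    calc (0 : ZMod 2) = (∑ i, (t i).b) + ∑ i, (t i).b := (CharTwo.add_self_eq_zero _).symm
      _ = (1 + ∑ i, (t i).b) + ∑ i, (t i).b := h2
      _ = 1 := by rw [add_assoc, CharTwo.add_self_eq_zero, add_zero]
  exact zero_ne_one this

/-! ## The hyperplane side of the full trap is still large -/

/-- The row matrix of the tuple. -/
def tupMat (t : Fin r → Hyp d) : Matrix (Fin r) (Fin d) (ZMod 2) := fun i => (t i).a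

/-- The constant term shared by the witnesses: `β₀ = r + 1 (mod 2)`. -/
def beta0 (r : ℕ) : ZMod 2 := (r : ZMod 2) + 1

/-- `r + β₀ = 1` in `F₂`. -/
theorem natCast_add_beta0 (r : ℕ) : (r : ZMod 2) + beta0 r = 1 := by
  unfold beta0
  rw [← add_assoc, CharTwo.add_self_eq_zero, zero_add]

/-- A solution `a'` of `⟪aᵢ, a'⟫ = 1 + bᵢ β₀` gives a hyperplane `(a', β₀)` adjacent to the whole trap
(unless it is a member). -/
theorem mem_hypsAdj_of_sol (hr : 1 ≤ r) (ht : LinearIndependent (ZMod 2) fun i => (t i).a)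
    {a' : Vec d} (ha' : a' ≠ 0) (hsol : a' ∈ solSet (tupMat t) (fun i => 1 + (t i).b * beta0 r))
    (hnot : (⟨(a', beta0 r), ha'⟩ : Hyp d) ∉ Bset hr t ht) :
    (⟨(a', beta0 r), ha'⟩ : Hyp d) ∈ hypsAdj (Bset hr t ht) := by
  classical
  rw [mem_solSet] at hsol
  have hi : ∀ i, (t i).a ⬝ᵥ a' = 1 + (t i).b * beta0 r := fun i => by
    have := congrFun hsol i
    simpa [tupMat, mulVec] using this
  rw [hypsAdj, Finset.mem_filter]
  refine ⟨Finset.mem_univ _, fun p hp => ⟨fun h => hnot (h ▸ hp), ?_⟩⟩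
  rcases (mem_Bset).1 hp with rfl | ⟨i, rfl⟩
  · -- p = p⋆
    simp only [pstar, Hyp.a, Hyp.b]
    rw [sum_dotProduct]
    simp_rw [hi]
    rw [Finset.sum_add_distrib, Finset.sum_const, Finset.card_univ, Fintype.card_fin, ← Finset.sum_mul]
    simp only [nsmul_eq_mul, mul_one]
    -- r + (Σ b) β₀ + (1 + Σ b) β₀ = r + β₀ = 1
    have e : (r : ZMod 2) + (∑ i, (t i).b) * beta0 r + (1 + ∑ i, (t i).b) * beta0 r = (r : ZMod 2) + beta0 r := by
      ring_nf
      rw [show (∑ i, (t i).b) * beta0 r * 2 = 0 by rw [mul_comm, show (2 : ZMod 2) = 0 from rfl, zero_mul]]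
      ring
    rw [e, natCast_add_beta0]
  · -- p = t i
    simp only [Hyp.a, Hyp.b]
    change (t i).a ⬝ᵥ a' + (t i).b * beta0 r = 1
    rw [hi, add_assoc, CharTwo.add_self_eq_zero, add_zero]

/-- **Lower bound on the hyperplane side of the full trap:** at least `2^(d-r) − (r + 2)` hyperplanes are
adjacent to all `r + 1` members. -/
theorem card_hypsAdj_Bset_ge (hr : 1 ≤ r) (ht : LinearIndependent (ZMod 2) fun i => (t i).a) :
    2 ^ (d - r) ≤ (hypsAdj (Bset hr t ht)).card + (r + 2) := by
  classical
  set c : Fin r → ZMod 2 := fun i => 1 + (t i).b * beta0 r with hc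
  have hrows : LinearIndependent (ZMod 2) (tupMat t).row := ht
  have hsol := (card_solSet (tupMat t) hrows c).1
  -- GOOD solutions: non-zero and not giving a member of the trap
  set BADset : Finset (Vec d) := insert 0 ((Bset hr t ht).image fun p => p.a) with hBAD
  have hBADcard : BADset.card ≤ r + 2 := by
    rw [hBAD]
    calc (insert 0 ((Bset hr t ht).image fun p => p.a)).card ≤ ((Bset hr t ht).image fun p => p.a).card + 1 :=
          Finset.card_insert_le _ _
      _ ≤ (Bset hr t ht).card + 1 := by gcongr; exact Finset.card_image_le
      _ ≤ (r + 1) + 1 := by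
          unfold Bset
          gcongr
          calc (insert (pstar hr t ht) (univ.image t)).card ≤ (univ.image t).card + 1 := Finset.card_insert_le _ _
            _ ≤ r + 1 := by
                gcongr
                calc (univ.image t).card ≤ (univ : Finset (Fin r)).card := Finset.card_image_le
                  _ = r := by simp
      _ = r + 2 := by ring
  set GOOD := (solSet (tupMat t) c) \ BADset with hGOOD
  have hGOODcard : 2 ^ (d - r) ≤ GOOD.card + (r + 2) := by
    have h1 : (solSet (tupMat t) c).card ≤ GOOD.card + BADset.card := by
      rw [hGOOD]
      have := Finset.card_sdiff_add_card_inter (solSet (tupMat t) c) BADset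
      have h2 : ((solSet (tupMat t) c) ∩ BADset).card ≤ BADset.card := Finset.card_le_card Finset.inter_subset_right
      omega
    omega
  -- GOOD injects into hypsAdj via a' ↦ (a', β₀), through the projection p ↦ p.a
  have hsub : GOOD ⊆ (hypsAdj (Bset hr t ht)).image fun p => p.a := by
    intro a' ha'
    rw [hGOOD, Finset.mem_sdiff] at ha'
    obtain ⟨hsolv, hnb⟩ := ha'
    have hne : a' ≠ 0 := fun h => hnb (by rw [hBAD, h]; exact Finset.mem_insert_self _ _)
    have hnot : (⟨(a', beta0 r), hne⟩ : Hyp d) ∉ Bset hr t ht := by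
      intro hmem
      apply hnb
      rw [hBAD]
      exact Finset.mem_insert_of_mem (Finset.mem_image.2 ⟨_, hmem, rfl⟩)
    exact Finset.mem_image.2 ⟨_, mem_hypsAdj_of_sol hr ht hne hsolv hnot, rfl⟩
  have := (Finset.card_le_card hsub).trans Finset.card_image_le
  omega

/-- Anchor (registered sub-goal `hw_family_anchor` of stmt-PneNP-9818): the trap has no common point. -/
theorem hw_family_anchor : ∀ (d r : ℕ) (hr : 1 ≤ r) (t : Fin r → Hyp d)
    (ht : LinearIndependent (ZMod 2) fun i => (t i).a), ptsOn (Bset hr t ht) = ∅ :=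
  fun _ _ hr _ ht => ptsOn_Bset hr ht

end Summit.PneNP.PneNP.Cruxes.RegularResolutionRung.SoundPathBottleneck.HadamardWitness

end
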